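import Summits.AtomisticToContinuum.BoseEinsteinCondensation.Theorems.FibreConductance.Negative.CosProductState

/-!
# Crux `FibreConductance` (stmt-AtomisticToContinuum-9480), line `parseval-shell-bootstrap` —
negative lemma on the stub `stub_shellOccupation`: (H1) cannot be relaxed to near-minimality

Refuter (drefute) support file.  `ShellOccupation` (the hardest stub of
`Lines/parseval-shell-bootstrap.lean`) bounds single-mode occupations of `|Φ|` on the resonant
shell by `K·N/(‖n‖²p₁)` for EXACT zero-free minimisers `Φ` (hypothesis (H1)).  Here: the same
statement with (H1) relaxed to `periodicEnergy v Φ ≤ E₀ + δ`, the slack `δ > 0` being chosen by the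
claimant together with `θ, ρ₀, K, N₀` (`ShellOccupationNearMinimiser`), is FALSE — already for the
free gas `v = 0`.  Witness (`CosProductState.lean`): the real, positive, Bose-symmetric product state
`Φ = g^{⊗N}`, `g = a + b(e_n + e_{-n}) = a + 2b cos(k·x)`, `a = 31s/33`, `b = 8s/33`, `s = L^{-3/2}`
(`a² + 2b² = s²`, `a - 2b = 15s/33 > 0`), `n = j e₀` with `j = ⌈18K⌉ + 2`, side `L = N/T²`,
`T = j + 2π/θ`, `M = 2π`, `p₁ = 1`, `p = -n`: the occupation of `φ_{-n}` in `|Φ| = Φ` is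
`N b²L³ = 64N/1089 > K N/j²`, while the excess (= total) energy is
`≤ N·4b²L³·|k|² = (1024π²/1089) j² T⁴/N → 0`, below any `δ > 0` for `N` large.  So (H1) enters any
proof of the stub through the EXACT ground-state structure (Euler–Lagrange / positivity /
Harnack), not through energy comparison with `O(1)` slack (compare `not_fibreConductanceNearMinimiser`
of the crux disproof for the crux itself).  Corollary: the stub with (H1) simply dropped is false
(`shellOccupation_false_without_minimiser`).
-/

noncomputable section

namespace Summit.AtomisticToContinuum.BoseEinsteinCondensation.Theorems.FibreConductance.Negative

open MeasureTheory Literature.MathematicalPhysics.QuantumManyBody.BoseGas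
open Summit.AtomisticToContinuum.BoseEinsteinCondensation.Theorems.GaussianDominationCan.Negative
open scoped ENNReal NNReal ComplexConjugate

/-! ### The statements -/

/-- `ShellOccupation` of `Lines/parseval-shell-bootstrap.lean` with the exact-minimiser hypothesis
(H1) `periodicEnergy v Φ = E₀` relaxed to `periodicEnergy v Φ ≤ E₀ + δ`, the slack `δ > 0` being at
the disposal of the claimant together with `θ, ρ₀, K, N₀` (everything else verbatim). -/
def ShellOccupationNearMinimiser : Prop :=
  ∀ v : ℝ → ℝ≥0∞, IsRepulsiveFiniteRange v → (∃ B : ℝ, ∀ r, v r ≤ ENNReal.ofReal B) →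
    ∀ M : ℝ, 0 < M → ∃ θ ρ₀ K : ℝ, 0 < θ ∧ 0 < ρ₀ ∧ 0 < K ∧ ∃ N₀ : ℕ, ∃ δ : ℝ≥0∞, 0 < δ ∧
     ∀ m : ℕ, N₀ ≤ m + 1 →
      ∀ L : ℝ, 0 < L → ((m + 1 : ℕ) : ℝ) ≤ ρ₀ * L ^ 3 → ∀ n : Fin 3 → ℤ, n ≠ 0 →
        2 * Real.pi * ‖(fun j => (n j : ℝ))‖ / L ≤ M * Real.sqrt ((m + 1 : ℕ) / L ^ 3) →
          ∀ Φ : PeriodicTrialState (m + 1) L,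
            periodicEnergy v Φ ≤ periodicGroundStateEnergy v (m + 1) L + δ → (∀ X, Φ.ψ X ≠ 0) →
              ∀ p₁ : ℝ, 0 < p₁ → p₁ ≤ θ * Real.sqrt ((m + 1 : ℕ) / L ^ 3) * L / (2 * Real.pi) →
                p₁ ≤ ‖(fun j => (n j : ℝ))‖ / 2 →
                  ∀ p : Fin 3 → ℤ, ‖(fun j => ((p j + n j : ℤ) : ℝ))‖ < p₁ →
                    cellOccupation (m + 1) L (planeWaveMode L p) (fun X => (‖Φ.ψ X‖ : ℂ)) ≤
                      ENNReal.ofReal (K * (m + 1 : ℕ) / (‖(fun j => (n j : ℝ))‖ ^ 2 * p₁))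

/-- `ShellOccupation` with (H1) simply dropped (all zero-free admissible states). -/
def ShellOccupationWithoutMinimiser : Prop :=
  ∀ v : ℝ → ℝ≥0∞, IsRepulsiveFiniteRange v → (∃ B : ℝ, ∀ r, v r ≤ ENNReal.ofReal B) →
    ∀ M : ℝ, 0 < M → ∃ θ ρ₀ K : ℝ, 0 < θ ∧ 0 < ρ₀ ∧ 0 < K ∧ ∃ N₀ : ℕ, ∀ m : ℕ, N₀ ≤ m + 1 →
      ∀ L : ℝ, 0 < L → ((m + 1 : ℕ) : ℝ) ≤ ρ₀ * L ^ 3 → ∀ n : Fin 3 → ℤ, n ≠ 0 →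
        2 * Real.pi * ‖(fun j => (n j : ℝ))‖ / L ≤ M * Real.sqrt ((m + 1 : ℕ) / L ^ 3) →
          ∀ Φ : PeriodicTrialState (m + 1) L, (∀ X, Φ.ψ X ≠ 0) →
              ∀ p₁ : ℝ, 0 < p₁ → p₁ ≤ θ * Real.sqrt ((m + 1 : ℕ) / L ^ 3) * L / (2 * Real.pi) →
                p₁ ≤ ‖(fun j => (n j : ℝ))‖ / 2 →
                  ∀ p : Fin 3 → ℤ, ‖(fun j => ((p j + n j : ℤ) : ℝ))‖ < p₁ →
                    cellOccupation (m + 1) L (planeWaveMode L p) (fun X => (‖Φ.ψ X‖ : ℂ)) ≤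
                      ENNReal.ofReal (K * (m + 1 : ℕ) / (‖(fun j => (n j : ℝ))‖ ^ 2 * p₁))

/-- Dropping (H1) is stronger than relaxing it. [folklore] -/
theorem shellOccupationNearMinimiser_of_without (h : ShellOccupationWithoutMinimiser) :
    ShellOccupationNearMinimiser := by
  intro v hv hB M hM
  obtain ⟨θ, ρ₀, K, hθ, hρ, hK, N₀, hmain⟩ := h v hv hB M hM
  exact ⟨θ, ρ₀, K, hθ, hρ, hK, N₀, 1, one_pos,
    fun m hm L hL hd n hn hw Φ _ hz => hmain m hm L hL hd n hn hw Φ hz⟩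

/-! ### The refutation -/

/-- **(H1) of `stub_shellOccupation` cannot be relaxed to `δ`-near-minimality**, for any slack
`δ > 0` chosen together with the constants: witness `v = 0`, `Φ = g^{⊗N}` (real, positive, nearly
free), `n = j e₀`, `p = -n`, `p₁ = 1`, dilute corner `L = N/T²`. [folklore] -/
theorem not_shellOccupationNearMinimiser : ¬ ShellOccupationNearMinimiser := by
  intro h
  obtain ⟨θ, ρ₀, K, hθ, hρ₀, hK, N₀, δ, hδ, h⟩ :=
    h 0 isRepulsiveFiniteRange_zero ⟨0, fun r => by simp⟩ (2 * Real.pi) (by positivity)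
  -- the mode number `j` and the vector `n = j e₀`
  set j : ℕ := ⌈18 * K⌉₊ + 2 with hj
  have hj2n : 2 ≤ j := by rw [hj]; omega
  have hj2 : (2 : ℝ) ≤ j := by exact_mod_cast hj2n
  have hjK : 18 * K < j := by
    rw [hj]; push_cast; linarith [Nat.le_ceil (18 * K)]
  have hjpos : (0 : ℝ) < j := by linarith
  clear_value j
  set nv : Fin 3 → ℤ := Pi.single 0 (j : ℤ) with hnv
  have hnv_ne : nv ≠ 0 := by
    intro h0
    have h1 := congrFun h0 0
    rw [hnv, Pi.single_eq_same] at h1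
    change (j : ℤ) = 0 at h1
    omega
  have hfun : (fun i => ((nv i : ℤ) : ℝ)) = Pi.single (0 : Fin 3) (j : ℝ) := by
    funext i
    fin_cases i <;> simp [hnv]
  have hnorm : ‖(fun i => ((nv i : ℤ) : ℝ))‖ = j := by
    rw [hfun, Pi.norm_single, Real.norm_natCast]
  have hnsq : nsq nv = (j : ℝ) ^ 2 := by
    simp [nsq, hnv, Fin.sum_univ_three]
  clear_value nv
  -- `T = √(N/L)`
  set T : ℝ := j + 2 * Real.pi / θ with hT
  have hT0 : 0 ≤ 2 * Real.pi / θ := by positivity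
  have hTj : (j : ℝ) ≤ T := by linarith
  have hT1 : 1 ≤ T := by linarith
  have hTpos : 0 < T := by linarith
  have hθT : θ * T = θ * j + 2 * Real.pi := by rw [hT]; field_simp
  clear_value T
  -- the particle number
  set E₁ : ℝ := 1024 * Real.pi ^ 2 * (j : ℝ) ^ 2 * T ^ 4 / (1089 * δ.toReal) with hE₁
  have hE₁nn : 0 ≤ E₁ := div_nonneg (by positivity) (mul_nonneg (by norm_num) ENNReal.toReal_nonneg)
  clear_value E₁
  obtain ⟨m, hmN₀, hmT⟩ := exists_large N₀ (T ^ 6 / ρ₀ + E₁ + 1)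
  set N : ℝ := ((m + 1 : ℕ) : ℝ) with hN
  have hN1 : (1 : ℝ) ≤ N := by rw [hN]; exact_mod_cast Nat.succ_le_succ (Nat.zero_le m)
  have hNpos : 0 < N := by linarith
  have hT6 : 0 ≤ T ^ 6 / ρ₀ := by positivity
  have hNT : T ^ 6 / ρ₀ ≤ N := by linarith
  have hNE : E₁ ≤ N := by linarith
  -- the side
  set L : ℝ := N / T ^ 2 with hL
  have hLpos : 0 < L := by positivity
  have hL3 : 0 < L ^ 3 := by positivity
  have hNne : N ≠ 0 := hNpos.ne'
  have hTne : T ≠ 0 := hTpos.ne'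
  have hsqrt : Real.sqrt (N / L ^ 3) = T ^ 3 / N := by
    rw [show N / L ^ 3 = (T ^ 3 / N) ^ 2 by rw [hL]; field_simp]
    exact Real.sqrt_sq (by positivity)
  have hsqrtL : Real.sqrt (N / L ^ 3) * L = T := by rw [hsqrt, hL]; field_simp
  -- density `N ≤ ρ₀ L³`
  have hdens : N ≤ ρ₀ * L ^ 3 := by
    have h1 : T ^ 6 ≤ ρ₀ * N := by
      have := (div_le_iff₀ hρ₀).mp hNT
      linarith
    rw [hL, div_pow, mul_div_assoc', le_div_iff₀ (by positivity)]
    calc N * (T ^ 2) ^ 3 = N * T ^ 6 := by ring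
      _ ≤ N * (ρ₀ * N) := mul_le_mul_of_nonneg_left h1 hNpos.le
      _ ≤ N * (ρ₀ * N) * N := le_mul_of_one_le_right (by positivity) hN1
      _ = ρ₀ * N ^ 3 := by ring
  -- window with `M = 2π`, `n = j e₀`: `j ≤ T`
  have hwin : 2 * Real.pi * ‖(fun i => ((nv i : ℤ) : ℝ))‖ / L ≤
      2 * Real.pi * Real.sqrt (N / L ^ 3) := by
    rw [hnorm, hsqrt, hL]
    rw [show 2 * Real.pi * (j : ℝ) / (N / T ^ 2) = 2 * Real.pi * ((j : ℝ) * T ^ 2 / N) by field_simp]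
    have hjT : (j : ℝ) * T ^ 2 ≤ T ^ 3 := by
      have := mul_le_mul_of_nonneg_right hTj (sq_nonneg T)
      linarith [this, show T * T ^ 2 = T ^ 3 by ring]
    gcongr
  clear_value L
  -- the state `g^{⊗N}`, `a = 31s/33`, `b = 8s/33`, `s = L^{-3/2}`
  set s : ℝ := (Real.sqrt (L ^ 3))⁻¹ with hs
  have hspos : 0 < s := by positivity
  have hs2 : s ^ 2 * L ^ 3 = 1 := by
    rw [hs, inv_pow, Real.sq_sqrt hL3.le, inv_mul_cancel₀ hL3.ne']
  set a : ℝ := 31 / 33 * s with ha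
  set b : ℝ := 8 / 33 * s with hb
  have hab : (a ^ 2 + 2 * b ^ 2) * L ^ 3 = 1 := by
    rw [show a ^ 2 + 2 * b ^ 2 = s ^ 2 by rw [ha, hb]; ring, hs2]
  have h2b : 2 * b < a := by rw [ha, hb]; linarith
  have hb0 : 0 ≤ b := by positivity
  have hbL : b ^ 2 * L ^ 3 = 64 / 1089 := by
    rw [hb]; linear_combination (64 / 1089 : ℝ) * hs2
  clear_value s a b
  -- near-minimality: excess energy `≤ (1024π²/1089) j² T⁴/N ≤ δ`
  have hE : periodicEnergy 0 (cosState m hLpos hnv_ne a b hab) ≤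
      periodicGroundStateEnergy 0 (m + 1) L + δ := by
    by_cases hδtop : δ = ⊤
    · rw [hδtop, add_top]; exact le_top
    have hδr : 0 < δ.toReal := ENNReal.toReal_pos hδ.ne' hδtop
    have hV : N * ((4 * (b ^ 2 * L ^ 3)) * (4 * Real.pi ^ 2 * nsq nv / L ^ 2)) =
        1024 * Real.pi ^ 2 * (j : ℝ) ^ 2 * T ^ 4 / (1089 * N) := by
      rw [hbL, hnsq, hL]; field_simp; ring
    refine (periodicEnergy_cosState_le hLpos hnv_ne hab).trans ?_
    refine (ENNReal.ofReal_le_of_le_toReal ?_).trans le_add_self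
    rw [hV, div_le_iff₀ (by positivity)]
    rw [hE₁] at hNE
    have := (div_le_iff₀ (by positivity)).mp hNE
    linarith [this]
  have hz : ∀ X, (cosState m hLpos hnv_ne a b hab).ψ X ≠ 0 := fun X => cosFun_ne_zero h2b hb0 X
  -- `p₁ = 1` is admissible
  have hp1a : (1 : ℝ) ≤ θ * Real.sqrt (N / L ^ 3) * L / (2 * Real.pi) := by
    rw [mul_assoc θ, hsqrtL, hθT, le_div_iff₀ (by positivity)]
    have := mul_pos hθ hjpos
    linarith
  have hp1b : (1 : ℝ) ≤ ‖(fun i => ((nv i : ℤ) : ℝ))‖ / 2 := by rw [hnorm]; linarith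
  -- the shell contains `p = -n`
  have hshell : ‖(fun i => (((-nv) i + nv i : ℤ) : ℝ))‖ < 1 := by
    have : (fun i => (((-nv) i + nv i : ℤ) : ℝ)) = 0 := by funext i; simp
    rw [this, norm_zero]; exact one_pos
  have key := h m hmN₀ L hLpos hdens nv hnv_ne hwin (cosState m hLpos hnv_ne a b hab) hE hz 1
    one_pos hp1a hp1b (-nv) hshell
  -- evaluate: occupation `64N/1089` versus the bound `K N/j²`
  have hmod : (fun X => ((‖(cosState m hLpos hnv_ne a b hab).ψ X‖ : ℝ) : ℂ)) = cosFun m L nv a b := by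
    funext X
    exact norm_cosFun_eq h2b hb0 X
  rw [hmod, cellOccupation_neg_cosFun hLpos hnv_ne hab, hnorm, mul_one, hbL] at key
  have h18 : 18 * K * (j : ℝ) < (j : ℝ) ^ 2 := by
    rw [sq]; exact mul_lt_mul_of_pos_right hjK hjpos
  have h36 : 36 * K ≤ 18 * K * (j : ℝ) := by
    have := mul_le_mul_of_nonneg_left hj2 (by positivity : (0 : ℝ) ≤ 18 * K)
    linarith
  have hKj : K < 64 / 1089 * (j : ℝ) ^ 2 := by linarith
  have hlt : K * N / (j : ℝ) ^ 2 < N * (64 / 1089) := by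
    rw [div_lt_iff₀ (by positivity)]
    have := mul_lt_mul_of_pos_left hKj hNpos
    linarith
  have hlt' := (ENNReal.ofReal_lt_ofReal_iff (by positivity)).mpr hlt
  exact absurd key (not_le.mpr hlt')

/-- **Corollary: (H1) is load-bearing for `stub_shellOccupation`** — with the minimiser hypothesis
dropped the statement is false. [folklore] -/
theorem shellOccupation_false_without_minimiser : ¬ ShellOccupationWithoutMinimiser :=
  fun h => not_shellOccupationNearMinimiser (shellOccupationNearMinimiser_of_without h)

end Summit.AtomisticToContinuum.BoseEinsteinCondensation.Theorems.FibreConductance.Negative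

end
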